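import Literature.AlgebraicGeometry.Frobenioids.ArithmeticFrobenioidNonDilating
import Literature.AlgebraicGeometry.Frobenioids.GeometricFrobenioidNonDilating
import HarnessLib

/-!
# Frobenioids I, Definition 1.1 (i) "non-dilating": the FACT-LIST row `IsNonDilating` SETTLED — a PREDICATE,
# universal closure REFUTED (squaring on `(ℕ, ·)` is dilating), instance forms at THE divisor monoids of §6 BY NAME

Mochizuki, *The geometry of Frobenioids I: the general theory*, Kyushu J. Math. **62** (2008) 293–400, Def. 1.1
(i), kurims p. 19: "we shall say that an endomorphism of monoids `α : M → M` is non-dilating if the endomorphism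
`α^char` of `M^char` … is the identity whenever `α^char(a) ≼ a` for all primary `a ∈ M^char`"
[cite: MochizukiFrdI2008, Def. 1.1 (i) p.19]; Ex. 3.7 pp. 70–71 ("dilating monoids")
[cite: MochizukiFrdI2008, Ex. 3.7 p.70]; Thm. 6.2 (iii) proof p. 112 and Thm. 6.4 (i) proof p. 115 ("`Φ` is
non-dilating") [cite: MochizukiFrdI2008, Thm. 6.2 (iii) p.112] [cite: MochizukiFrdI2008, Thm. 6.4 (i) p.115].

PROOF-ONLY companion of `ElementaryFrobenioid.lean` (cell abc-iut, seat abc-iut-f-001, F fact-proving wave, FROZEN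
FACT-LIST row **F-1073** `IsNonDilating`; no definition, no statement re-typed, the declaring file is imported
through the §6 proof files, never edited).  The row names seat abc-iut-found's DEFINITION
`IsNonDilating (α : M →* M) : Prop` — a predicate of Def. 1.1 (i), not a claim of the paper; its "universal closure"
(every endomorphism of every commutative monoid is non-dilating) is FALSE, and what the [FrdI] §6 cone actually
uses are its INSTANCES at the pull-back endomorphisms of THE divisor monoids of Ex. 6.1 / Ex. 6.3, which are
theorems of seat abc-iut-L6-t10.  This file records, kernel-checked (plan rule R5):

* `not_isNonDilating_powMonoidHom_two` — the squaring endomorphism of the multiplicative monoid `ℕ` is NOT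
  non-dilating (`(ℕ, ·)^char = (ℕ, ·)`, units trivial; `a² ≼ a` for every `a`, yet `2² ≠ 2`): a Mathlib-level
  witness of the kind the paper's own Ex. 3.7 exhibits (Ex. 3.7 is in the tree as `Ex37.notNonDilating_holds`);
* `not_isNonDilating_univ` — hence the universal closure `∀ M α, IsNonDilating α` is FALSE (row F-1073 is a
  predicate: consumable only through its proved instances);
* `isNonDilating_pull_arithDivisorFunctor`, `isNonDilating_pull_geomDivisorFunctor` — THE instances: every
  endomorphism `σ` of `Spec L` in `D` pulls back to a non-dilating endomorphism `σ^*` of `Φ(L)`, for THE arithmetic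
  divisor monoid of Ex. 6.3 (number fields; Thm. 6.4 (i) proof p. 115) and THE monoid of Cartier effective divisors
  of Ex. 6.1 (every `GeometricDivisorData`; Thm. 6.2 (iii) proof p. 112) — seat abc-iut-L6-t10's
  `arithDivisorFunctor_isNonDilatingOn` / `geomDivisorFunctor_isNonDilatingOn` BY NAME, stated per endomorphism in
  the row's own vocabulary `IsNonDilating (pull Φ σ)`.

(The equivalence with seat abc-iut-L1-t3's pointwise rendering `PreFrobenioidData.IsNonDilating` is already in the
tree: `PreFrobenioidData.isNonDilating_iff_isNonDilating`, `PerfectionStandardTypes.lean`.)  Nothing here bears on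
[IUTchIII] Cor. 3.12 or asserts anything about abc; no side taken.
-/

noncomputable section

namespace Literature.AlgebraicGeometry.Frobenioids

open CategoryTheory

/-! ### The universal closure is false: squaring on `(ℕ, ·)` is dilating -/

/-- On the multiplicative monoid `ℕ`, the map induced by squaring on `ℕ^char = Associates ℕ` is squaring.
[cite: MochizukiFrdI2008, Def. 1.1 (i) p.19] -/
theorem associatesMap_powMonoidHom_two (a : Associates ℕ) :
    associatesMap (powMonoidHom 2 : ℕ →* ℕ) a = a ^ 2 := by
  obtain ⟨n, rfl⟩ := Associates.mk_surjective a
  rw [associatesMap_mk, powMonoidHom_apply, Associates.mk_pow]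

/-- **Squaring on `(ℕ, ·)` is NOT non-dilating** (Def. 1.1 (i)): `α^char(a) = a² ≼ a` for every `a` (indeed
`a² ∣ a²`), in particular for every primary `a`, but `α^char ≠ id` since `4` and `2` are not associated in `ℕ`
(units of `ℕ` are trivial).  Compare the paper's Ex. 3.7 ("dilating monoids", `Ex37.notNonDilating_holds`).
[cite: MochizukiFrdI2008, Def. 1.1 (i) p.19] -/
theorem not_isNonDilating_powMonoidHom_two :
    ¬ Literature.AlgebraicGeometry.Frobenioids.IsNonDilating (powMonoidHom 2 : ℕ →* ℕ) := by
  intro h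
  have hyp : ∀ a : Associates ℕ, IsPrimary a → associatesMap (powMonoidHom 2 : ℕ →* ℕ) a ≼ a :=
    fun a _ => ⟨2, two_pos, by rw [associatesMap_powMonoidHom_two]⟩
  have h4 : associatesMap (powMonoidHom 2 : ℕ →* ℕ) (Associates.mk 2) = Associates.mk 2 := by
    rw [h hyp, MonoidHom.id_apply]
  rw [associatesMap_mk, powMonoidHom_apply] at h4
  have h42 : (2 ^ 2 : ℕ) = 2 := Associates.mk_injective h4
  norm_num at h42

/-- **The universal closure of FACT-LIST row F-1073 `IsNonDilating` is FALSE**: not every endomorphism of every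
commutative monoid is non-dilating (witness: squaring on `(ℕ, ·)`).  The row is a PREDICATE of Def. 1.1 (i) —
consumable only through its proved instances (below). [cite: MochizukiFrdI2008, Def. 1.1 (i) p.19] -/
theorem not_isNonDilating_univ :
    ¬ ∀ (M : Type) [CommMonoid M] (α : M →* M), Literature.AlgebraicGeometry.Frobenioids.IsNonDilating α :=
  fun h => not_isNonDilating_powMonoidHom_two (h ℕ (powMonoidHom 2))

/-! ### THE instances the §6 cone consumes -/

section Instances

/-- **Instance form at THE arithmetic divisor monoid of Ex. 6.3** (Thm. 6.4 (i) proof, p. 115: "`Φ` is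
non-dilating"): for every number field `F`, every `K/F`, every `Spec L ∈ Ob(D)` and every endomorphism `σ` of
`Spec L` in `D = B(Gal(K/F))⁰`, the pull-back `σ^* : Φ(L) → Φ(L)` of effective arithmetic divisors is non-dilating —
seat abc-iut-L6-t10's `arithDivisorFunctor_isNonDilatingOn` BY NAME. [cite: MochizukiFrdI2008, Thm. 6.4 (i) p.115] -/
theorem isNonDilating_pull_arithDivisorFunctor (F : Type) [Field F] [NumberField F] (K : Type) [Field K]
    [Algebra F K] (X : FinSubextCat F K) (σ : X ⟶ X) :
    Literature.AlgebraicGeometry.Frobenioids.IsNonDilating (pull (arithDivisorFunctor F K) σ) :=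
  arithDivisorFunctor_isNonDilatingOn F K X σ

/-- **Instance form at THE monoid of Cartier effective divisors of Ex. 6.1** (Thm. 6.2 (iii) proof, p. 112: "`Φ` is
non-dilating"): for every field `K`, every `K̃/K`, every instance `Γ` of the interface `GeometricDivisorData K K̃`,
every `Spec L ∈ Ob(D)` and every endomorphism `σ` of `Spec L` in `D`, the pull-back `σ^* : Φ(L) → Φ(L)` is
non-dilating — seat abc-iut-L6-t10's `geomDivisorFunctor_isNonDilatingOn` BY NAME.
[cite: MochizukiFrdI2008, Thm. 6.2 (iii) p.112] -/
theorem isNonDilating_pull_geomDivisorFunctor {K : Type} [Field K] {Kt : Type} [Field Kt] [Algebra K Kt]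
    (Γ : GeometricDivisorData K Kt) (X : FinSubextCat K Kt) (σ : X ⟶ X) :
    Literature.AlgebraicGeometry.Frobenioids.IsNonDilating (pull (geomDivisorFunctor Γ) σ) :=
  geomDivisorFunctor_isNonDilatingOn Γ X σ

end Instances

end Literature.AlgebraicGeometry.Frobenioids

end
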